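import Summits.QuantumFields.YangMills.Theorems.AlphaInputsT3ACv3EMLTwoFieldIterUniformAllL
import Summits.QuantumFields.YangMills.Theorems.AlphaInputsT3ACv3FLExpUpdate
import HarnessLib

/-!
# `AlphaInputsT3ACv3FLExpUpdateAllL` — ★w1 g0's DEFECT AFTER THE EXPONENTIAL UPDATE (`FLContraction.norm_defect_after_expUpdate_le`, memo v2.1 row R6, the UPDATE) AT **EVERY**
# BLOCK SIZE `L ≥ 2`: the proviso `d + 2 ≤ L` is removed by taking the derivative row from `…EMLTwoFieldIterUniformAllL` (Duhamel form, p594803) — the (FL) Newton route's update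
# estimate at `L = 3`, which `HistoryTailL` ∕ `FluctuationComparisonRegPrIntL` ∕ 2′χ need (`∀ odd L > 1`) — cell `ym3-torus`, width seat `ym-ust-19936-w5` (g0); fourth file of the
# `…AllL` set (p593768, p594803, `…FLContractionCoreAllL`)

WHAT.  Verbatim ★w1's statement and proof — `U′_b = e^{a_b}U_b`, `‖a_b‖ ≤ α ≤ 1`, `U` `δ`-close to `1`, `Q^{(k)}a` reproducing the defect on `S` up to `τ₀` — with: NO `d + 2 ≤ L`; `k ≤ m + K`;
natural scales WITHOUT the group-dimension factor (`norm_iterLin_le'`); the derivative-row error `C₂·m_k(2α)(m_k(2α) + m_k(δ))`, `C₂ = (d+1)·18^d(2+(d+1)18^d)·5200ℓ²/(L(L−1))`, under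
the four smallness rows of `…EMLTwoFieldIterUniformAllL` at `ρ := 2α`.  Conclusion on `S`: `‖V(c) − Ū′^{(k)}(c)‖ ≤ τ₀ + (d+1)L^k(αδ + α²) + C₂·m_k(2α)(m_k(2α) + m_k(δ))`.
HONEST FRAMING.  As R6's update: bookkeeping over landed lemmas (★w1's `norm_expUpdate_sub_le`, `iterLin_sub`; the AllL derivative row); (FL)∕`hLift`∕KIN NOT proved; count-neutral
helper toward R3 2′∕2′χ (`--supports stmt-QuantumFields-19936`); registry untouched; nothing about d = 4, the continuum, or a mass gap; YM₃ on T³ is rung R3, not Clay.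

References: T. Bałaban, Commun. Math. Phys. 98 (1985) 17–51 [Balaban1985Averaging] (Prop. 4 (134)–(135) p.38, Prop. 5 (156)–(157) p.42); CMP 102 (1985) 277–309
[Balaban1985Variational] ((15)–(17) p.280); CMP 109 (1987) 249–301 [Balaban1987RG1] ((0.4), (0.11) p.253).
-/

set_option autoImplicit false

noncomputable section

namespace Summit.QuantumFields.YangMills.Theorems.FLContractionAllL

open Finset NormedSpace
open scoped Matrix.Norms.L2Operator
open Literature.MathematicalPhysics.QuantumFieldTheory.Balaban1983to89
open T4Continuum AveragingRT BlockAveraging ExpMeanLog BlockAveragingEMLLinearised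
open Summit.QuantumFields.YangMills.Theorems.LinearLiftMatrix (norm_iterLin_le')
open Summit.QuantumFields.YangMills.Theorems.FLContraction (iterLin_sub norm_expUpdate_sub_le)
open Summit.QuantumFields.YangMills.Theorems.EMLIterUniformAllL (norm_iter_sub_iter_sub_iterLin_le_uniform_allL)

variable {P : Params} {n : Type*} [Fintype n] [DecidableEq n] [Nonempty n]

/-- ★★ **THE DEFECT AFTER THE EXPONENTIAL UPDATE, AT EVERY BLOCK SIZE `L ≥ 2`** (★w1's `FLContraction.norm_defect_after_expUpdate_le` with the AllL derivative row): for `U′_b = e^{a_b}U_b`,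
`‖a_b‖ ≤ α ≤ 1`, `‖U_b − 1‖ ≤ δ`, `k ≤ m + K`, and `‖Q^{(k)}a(c) − (V(c) − Ū^{(k)}(c))‖ ≤ τ₀` on `S`, under the four smallness rows at `ρ := 2α`:
`‖V(c) − Ū′^{(k)}(c)‖ ≤ τ₀ + (d+1)L^k(αδ + α²) + C₂·m_k(2α)(m_k(2α) + m_k(δ))` on `S`, `m_k(x) = (d+1)L^k x` — NO `k` and NO `L`-threshold in the constants.
[cite: Balaban1985Averaging, Prop. 4 (134)–(135) p.38; Balaban1985Variational, (15)–(17) p.280] -/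
theorem norm_defect_after_expUpdate_le_allL
    (Q : (i : ℕ) → (PBond P 0 → Matrix n n ℂ) → PBond P i → Matrix n n ℂ)
    (hQ0 : ∀ Y, Q 0 Y = Y) (hQs : ∀ (i : ℕ) (Y : PBond P 0 → Matrix n n ℂ) (c : PBond P (i + 1)), Q (i + 1) Y c = linAvg (Q i Y) c)
    (k : ℕ) (hk : k ≤ P.m + P.K) (U U' : GaugeField P 0 (Matrix.specialUnitaryGroup n ℂ)) (a : PBond P 0 → Matrix n n ℂ) {α δ : ℝ} (hδ : 0 ≤ δ) (hα1 : α ≤ 1)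
    (hU' : ∀ b, ((U' b : Matrix.specialUnitaryGroup n ℂ) : Matrix n n ℂ) = exp (a b) * ((U b : Matrix.specialUnitaryGroup n ℂ) : Matrix n n ℂ))
    (ha : ∀ b, ‖a b‖ ≤ α) (hU : ∀ b, ‖((U b : Matrix.specialUnitaryGroup n ℂ) : Matrix n n ℂ) - 1‖ ≤ δ)
    (hmδ : (((P.d : ℝ) + 1) * ((18 : ℝ) ^ P.d * (2 + ((P.d : ℝ) + 1) * (18 : ℝ) ^ P.d)) * (324 * (((P.d + 2) * P.L : ℕ) : ℝ) ^ 2) / ((P.L : ℝ) * ((P.L : ℝ) - 1))) * (((P.d : ℝ) + 1) * (P.L : ℝ) ^ k * δ) ≤ 1)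
    (h200 : 200 * (((P.d + 2) * P.L : ℕ) : ℝ) * ((((P.d : ℝ) + 1) * (P.L : ℝ) ^ k * (2 * α)) + (((P.d : ℝ) + 1) * (P.L : ℝ) ^ k * δ)) ≤ 1)
    (hm : (((P.d : ℝ) + 1) * ((18 : ℝ) ^ P.d * (2 + ((P.d : ℝ) + 1) * (18 : ℝ) ^ P.d)) * (5200 * (((P.d + 2) * P.L : ℕ) : ℝ) ^ 2) / ((P.L : ℝ) * ((P.L : ℝ) - 1))) * ((((P.d : ℝ) + 1) * (P.L : ℝ) ^ k * (2 * α)) + (((P.d : ℝ) + 1) * (P.L : ℝ) ^ k * δ)) ≤ 1)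
    (hN : 4 * (((P.d + 2) * P.L : ℕ) : ℝ) * ((((P.d : ℝ) + 1) * (P.L : ℝ) ^ k * (2 * α)) + (((P.d : ℝ) + 1) * (P.L : ℝ) ^ k * δ)) < deltaSU n)
    (V : GaugeField P k (Matrix.specialUnitaryGroup n ℂ)) (S : Set (PBond P k)) {τ₀ : ℝ}
    (hQa : ∀ c ∈ S, ‖Q k a c - (((V c : Matrix.specialUnitaryGroup n ℂ) : Matrix n n ℂ) -
        ((Averaging.iter (fun i => blockAvg (P := P) (j := i) (expMeanLogSU (n := n))) k U c : Matrix.specialUnitaryGroup n ℂ) : Matrix n n ℂ))‖ ≤ τ₀) :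
    ∀ c ∈ S, ‖((V c : Matrix.specialUnitaryGroup n ℂ) : Matrix n n ℂ) -
        ((Averaging.iter (fun i => blockAvg (P := P) (j := i) (expMeanLogSU (n := n))) k U' c : Matrix.specialUnitaryGroup n ℂ) : Matrix n n ℂ)‖ ≤
      τ₀ + ((P.d : ℝ) + 1) * (P.L : ℝ) ^ k * (α * δ + α ^ 2) + (((P.d : ℝ) + 1) * ((18 : ℝ) ^ P.d * (2 + ((P.d : ℝ) + 1) * (18 : ℝ) ^ P.d)) * (5200 * (((P.d + 2) * P.L : ℕ) : ℝ) ^ 2) / ((P.L : ℝ) * ((P.L : ℝ) - 1))) * ((((P.d : ℝ) + 1) * (P.L : ℝ) ^ k * (2 * α)) * ((((P.d : ℝ) + 1) * (P.L : ℝ) ^ k * (2 * α)) + (((P.d : ℝ) + 1) * (P.L : ℝ) ^ k * δ))) := by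
  -- the derivative row at `(U′, U)` (every `L ≥ 2`), then generalise its constant
  have hsize : ∀ c : PBond P 0, 0 ≤ α := fun c => (norm_nonneg _).trans (ha c)
  have hρ : ∀ b, ‖((U' b : Matrix.specialUnitaryGroup n ℂ) : Matrix n n ℂ) - ((U b : Matrix.specialUnitaryGroup n ℂ) : Matrix n n ℂ)‖ ≤ 2 * α :=
    fun b => (norm_expUpdate_sub_le U U' a hα1 hU' ha hU b).1
  have hZa : ∀ b, ‖(((U' b : Matrix.specialUnitaryGroup n ℂ) : Matrix n n ℂ) - ((U b : Matrix.specialUnitaryGroup n ℂ) : Matrix n n ℂ)) - a b‖ ≤ α * δ + α ^ 2 :=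
    fun b => (norm_expUpdate_sub_le U U' a hα1 hU' ha hU b).2
  intro c hc
  have hα0 : 0 ≤ α := hsize ⟨fun _ => 0, c.dir⟩
  have hderiv0 := (norm_iter_sub_iter_sub_iterLin_le_uniform_allL Q hQ0 hQs U' U hδ (by positivity) hU hρ k hk hmδ h200 hm hN k le_rfl c).2
  obtain ⟨ek, hek⟩ : ∃ x : ℝ, x = (((P.d : ℝ) + 1) * ((18 : ℝ) ^ P.d * (2 + ((P.d : ℝ) + 1) * (18 : ℝ) ^ P.d)) * (5200 * (((P.d + 2) * P.L : ℕ) : ℝ) ^ 2) / ((P.L : ℝ) * ((P.L : ℝ) - 1))) * ((((P.d : ℝ) + 1) * (P.L : ℝ) ^ k * (2 * α)) * ((((P.d : ℝ) + 1) * (P.L : ℝ) ^ k * (2 * α)) + (((P.d : ℝ) + 1) * (P.L : ℝ) ^ k * δ))) := ⟨_, rfl⟩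
  rw [← hek] at hderiv0 ⊢
  set Z : PBond P 0 → Matrix n n ℂ := fun b => ((U' b : Matrix.specialUnitaryGroup n ℂ) : Matrix n n ℂ) - ((U b : Matrix.specialUnitaryGroup n ℂ) : Matrix n n ℂ) with hZ
  -- `Q k Z − Q k a = Q k (Z − a)`, bounded on the natural scale (no group-dimension factor)
  have hlin : ‖Q k Z c - Q k a c‖ ≤ ((P.d : ℝ) + 1) * (P.L : ℝ) ^ k * (α * δ + α ^ 2) := by
    rw [← iterLin_sub Q hQ0 hQs]
    exact norm_iterLin_le' Q hQ0 hQs _ hZa k c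
  set Φ : Matrix n n ℂ := ((Averaging.iter (fun i => blockAvg (P := P) (j := i) (expMeanLogSU (n := n))) k U c : Matrix.specialUnitaryGroup n ℂ) : Matrix n n ℂ)
  set Φ' : Matrix n n ℂ := ((Averaging.iter (fun i => blockAvg (P := P) (j := i) (expMeanLogSU (n := n))) k U' c : Matrix.specialUnitaryGroup n ℂ) : Matrix n n ℂ)
  set Vc : Matrix n n ℂ := ((V c : Matrix.specialUnitaryGroup n ℂ) : Matrix n n ℂ)
  have hderiv : ‖Φ' - Φ - Q k Z c‖ ≤ ek := hderiv0
  have e : Vc - Φ' = -(Q k a c - (Vc - Φ)) - (Q k Z c - Q k a c) - (Φ' - Φ - Q k Z c) := by abel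
  rw [e]
  calc ‖-(Q k a c - (Vc - Φ)) - (Q k Z c - Q k a c) - (Φ' - Φ - Q k Z c)‖
      ≤ ‖-(Q k a c - (Vc - Φ))‖ + ‖Q k Z c - Q k a c‖ + ‖Φ' - Φ - Q k Z c‖ := (norm_sub_le _ _).trans (add_le_add (norm_sub_le _ _) le_rfl)
    _ ≤ _ := by rw [norm_neg]; exact add_le_add (add_le_add (hQa c hc) hlin) hderiv

end Summit.QuantumFields.YangMills.Theorems.FLContractionAllL

end
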